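import Literature.Probability.RandomPlanarGeometry.RestrictionExitTime
import Literature.Probability.RandomPlanarGeometry.LoewnerReflection
import Literature.Probability.RandomPlanarGeometry.LoewnerSlidHullStar
import HarnessLib

/-!
# [LSW] Lemma 6.2 for every continuous driving function: proof of `restrictionDeriv_exitTime_gt`

G. F. Lawler, O. Schramm, W. Werner, *Conformal restriction: the chordal case*, J. Amer. Math.
Soc. **16** (2003) 917–955, arXiv:math/0209343 (**[LSW]**), Lemma 6.2: "Let `A ∈ 𝒬₊`, let
`W : [0, ∞) → ℝ` be continuous, and let `g_t` be the corresponding solution of (2.5). Let `K_t`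
be the associated growing hull, and suppose that `⋃_{t>0} K_t ∩ A = ∅`. Let
`T(r) := sup{t ≥ 0 : K_t ⊂ r𝕌}` and `A_t = g_t(A)`. Then `lim_{r → ∞} g'_{A_{T(r)}}(W_{T(r)}) = 1`."

The tree vendors this as the named fact `Loewner.restrictionDeriv_exitTime_gt`
(`SLERestrictionLemmas`) and proves it for chains from the origin generated by a SIMPLE curve
(`RestrictionExitTime`, through the continuous boundary extension of `f_t = g_t⁻¹` and the two
sides of the cross-cut `γ[0, t]`). This file proves the fact itself
(`Loewner.restrictionDeriv_exitTime_gt_holds`) — for EVERY continuous driving function, whose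
hulls need not be locally connected, so that `f_t` need not have boundary values — and in fact
for every `*`-hull `A` (`Loewner.restrictionDeriv_exitTime_gt_of_isStarHull`).

## The printed proof and its formalization

[LSW]: "Set `T := T(r)`, `W := W_T`, `a₀ := inf (A ∩ ℝ)`, `a₁ := sup (A ∩ ℝ)`, `A' := A ∪ [a₀, a₁]`
and `Ã := g_T(A')`. Let `r' = sup{|z| : z ∈ K_T}` … and let `z₀ ∈ K_T` be such that `|z₀| = r'`.
Set `β(s) := z₀ + (1 − s)i`. Then the limit `w := lim_{s ↗ 1} g_T ∘ β(s)` exists … Moreover,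
since `β(1) = z₀`, we must have `w = W`. … The extremal length from `A'` to the circle
`|z| = r'` goes to infinity with `r`. By monotonicity and conformal invariance of extremal
length, the extremal length in `ℍ` between `Ã` and `(−∞, W]` goes to infinity as well. Because
`Ã` is connected, this implies that `diam(Ã)/inf{|W − z| : z ∈ Ã}` goes to zero. Since
`g_B'(W)` is invariant under scaling … and is monotone decreasing in `B` … the lemma follows."

All steps are PROVED here, for a continuous `W` and a hull `A` whose real points lie to the
right of `W_0` (the situation of the printed proof, where `W_0 = 0 < a₀`):

1. *The exit point* (`exists_exitPoint`, `swallowingTime_exitPoint`): `K̂_t` (the closed hull,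
   compact) has a point `z₀` of maximal modulus `≥ r`, swallowed exactly at time `t`, and the
   vertical ray above it lies in `H_t` (`add_mul_I_mem_domain_of_max`).
2. *The key limit `g_t(z₀ + iy) → W_t`* (`norm_map_sub_driving_lt_of_vertical`), WITHOUT
   boundary behaviour of conformal maps: `g_t = g^{(s)}_{t−s} ∘ g_s` (cocycle) with `s ↗ t`
   along times where `|g_s(z₀) − W_s|` is small (`exists_norm_map_sub_driving_lt_near`), the map
   of the chain driven by `W(s + ·)` moving points by `O(osc W + √(t − s))`.
3. *Far points* (`exists_norm_map_vertical_sub_driving_eq`): consequently every semicircle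
   about `W_t` contains a point of `ℍ` whose `f_t`-preimage lies on that vertical ray, of
   modulus `> r` — this is what "the extremal length between `Ã` and `(−∞, W]`" sees of the
   circle `|z| = r'`.
4. *`A'` and `Ã`*: the points of `A' = A ∪ [a₀, b]` are still flowing at time `t`
   (`lt_swallowingTime_of_disjoint_closedHull`, `swallowingTime_mono_right`), `g_t` is
   continuous there and real increasing on the flowing reals; by the intermediate value theorem
   on the connected `A'` every semicircle of radius `u ≤ m := max_{A'} |g_t − g_t(a₀)|` about
   `g_t(a₀)` carries a point of `ℍ` with preimage of modulus `< R₀` (`exists_mem_sphere_of_ofReal`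
   perturbs a real such point into `ℍ`, again by the intermediate value theorem).
5. *Length–area* (`mul_log_le_of_forall_crossing_or_overlap`, a variant of the tree's
   `AnnulusCrossing.mul_log_le_of_forall_crossing_or` whose two families of semicircles — about
   `p = g_t(a₀) − W_t` and about `0` — cross INSIDE `ℍ`, `exists_mem_inter_spheres`): one of the
   two semicircles through each parameter crosses an annulus of logarithmic width
   `≍ log (r/R₀)`, whence `m ≤ δ p` for large `r` (`exists_slidHull_subset_closedBall_of_driving_lt`).
6. *Comparison* (`restrictionDeriv_exitTime_gt_of_driving_lt`): the slid hull
   `A_t − W_t ⊆ D̄(p, δp)` is a `*`-hull (`isStarHull_slidHull_of_disjoint`), so `Φ'(0) > 1 − ε`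
   by `exists_delta_lt_restrictionDeriv` (thin half-ellipse hulls and antitonicity).

Hulls to the LEFT of `W_0` follow by the reflection `σ(z) = −z̄` (`LoewnerReflection`;
`restrictionDeriv_exitTime_gt_of_lt_driving`), and an arbitrary `*`-hull is split into its
parts attached right and left of `W_0` (`IsStarHull.sidePart_decomposition` of the translate
`A − W_0`; `IsBoundedHull.image_add_const`), which are combined at the same exit times by the
union bound `HasRestrictionDeriv.one_sub_le_add` (`RestrictionSubadditivity`), exactly as [LSW]
treat two-sided hulls in the proof of Thm. 6.1.

## References

* [LSW] Lemma 6.2 and its proof, §2 p. 8, Prop. 4.1 [LawlerSchrammWerner2003Restriction].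
* G. F. Lawler, *Conformally Invariant Processes in the Plane* (2005), Ch. 4 §4.1 [Lawler2005].
* Ch. Pommerenke, *Boundary Behaviour of Conformal Maps* (1992), Prop. 2.2 [PommerenkeBBCM1992].
-/

noncomputable section

open Set Filter Topology Metric Complex
open UpperHalfPlane (upperHalfPlaneSet isOpen_upperHalfPlaneSet)
open scoped NNReal Real

namespace Literature.Probability.RandomPlanarGeometry

section LengthArea

open MeasureTheory
open scoped ENNReal

/-! ### Two overlapping families of semicircles (length–area) -/

/-- **Two families of semicircles crossing inside `ℍ`.** The variant of
`AnnulusCrossing.mul_log_le_of_forall_crossing_or` in which the second family consists of the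
semicircles about `0` of radius `p + m/2 - u` (instead of `p - u`), `u ∈ (m/2, m)`: these meet
the semicircles of radius `u` about `p` INSIDE the open half-plane (no junction on the real
axis, where the conformal map need not have boundary values). Let `f` be holomorphic and
injective on `ℍ`, `0 < m < p`, `L > 0`, `0 < R₁ < R₂`, `0 < R₃ < R₄` with `L ≤ log (R₂/R₁)`,
`L ≤ log (R₄/R₃)`; if for every `u ∈ (m/2, m)` one of the two semicircles is mapped onto a
curve crossing the corresponding annulus, then `L · log 2 · m ≤ 2π² (m + 2p)` (same proof:
`lintegral_inv_le_of_forall_crossing` for each family, the substitution `s = p + m/2 - u`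
being an isometry with `du/u ≤ (2p/m) ds/s` on the relevant range).
[cite: PommerenkeBBCM1992, Prop. 2.2] -/
theorem mul_log_le_of_forall_crossing_or_overlap {f : ℂ → ℂ} (hf : DifferentiableOn ℂ f upperHalfPlaneSet)
    (hinj : InjOn f upperHalfPlaneSet)
    {R₁ R₂ R₃ R₄ L p m : ℝ} (hR₁ : 0 < R₁) (hR₁₂ : R₁ < R₂) (hR₃ : 0 < R₃) (hR₃₄ : R₃ < R₄)
    (hL : 0 < L) (hL₁ : L ≤ Real.log (R₂ / R₁)) (hL₂ : L ≤ Real.log (R₄ / R₃)) (hm : 0 < m)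
    (hmp : m < p)
    (hcross : ∀ u ∈ Ioo (m / 2) m,
      (∃ θ' ∈ Ioo (0 : ℝ) π, ∃ θ'' ∈ Ioo (0 : ℝ) π,
        ‖f (circleMap (p : ℂ) u θ')‖ < R₁ ∧ R₂ < ‖f (circleMap (p : ℂ) u θ'')‖) ∨
      (∃ θ' ∈ Ioo (0 : ℝ) π, ∃ θ'' ∈ Ioo (0 : ℝ) π,
        ‖f (circleMap 0 (p + m / 2 - u) θ')‖ < R₃ ∧ R₄ < ‖f (circleMap 0 (p + m / 2 - u) θ'')‖)) :
    L * Real.log 2 * m ≤ 2 * π ^ 2 * (m + 2 * p) := by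
  have hfc : ContinuousOn f upperHalfPlaneSet := hf.continuousOn
  have hp : 0 < p := hm.trans hmp
  -- the radii of the first kind
  set S₁ : Set ℝ := {u : ℝ | 0 < u ∧ ∃ θ' ∈ Ioo (0 : ℝ) π, ∃ θ'' ∈ Ioo (0 : ℝ) π,
      ‖f (circleMap (p : ℂ) u θ')‖ < R₁ ∧ R₂ < ‖f (circleMap (p : ℂ) u θ'')‖} ∩ Ioo (m / 2) m with hS₁
  have hS₁m : MeasurableSet S₁ :=
    (Literature.Analysis.Complex.AnnulusCrossing.isOpen_setOf_crossing hfc p R₁ R₂).measurableSet.inter measurableSet_Ioo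
  have hS₁0 : S₁ ⊆ Ioi 0 := fun u hu ↦ hu.1.1
  have hI₁ : ∫⁻ u in S₁, ENNReal.ofReal u⁻¹ ≤ ENNReal.ofReal (2 * π ^ 2 / L) :=
    (Literature.Analysis.Complex.AnnulusCrossing.lintegral_inv_le_of_forall_crossing hf hinj hR₁ hR₁₂ hS₁m hS₁0
      fun u hu ↦ hu.1.2).trans
      (ENNReal.ofReal_le_ofReal (div_le_div_of_nonneg_left (by positivity) hL hL₁))
  -- the radii of the second kind, and their reflections `s = p - u`
  set S₂ : Set ℝ := Ioo (m / 2) m \ S₁ with hS₂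
  have hS₂m : MeasurableSet S₂ := measurableSet_Ioo.diff hS₁m
  have hS₂sub : S₂ ⊆ Ioo (m / 2) m := fun u hu ↦ hu.1
  have hcross₂ : ∀ u ∈ S₂, ∃ θ' ∈ Ioo (0 : ℝ) π, ∃ θ'' ∈ Ioo (0 : ℝ) π,
      ‖f (circleMap 0 (p + m / 2 - u) θ')‖ < R₃ ∧ R₄ < ‖f (circleMap 0 (p + m / 2 - u) θ'')‖ := by
    intro u hu
    have hu0 : 0 < u := (half_pos hm).trans hu.1.1
    rcases hcross u hu.1 with h | h
    · exact absurd ⟨⟨hu0, h⟩, hu.1⟩ hu.2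
    · exact h
  set e : ℝ ≃ᵐ ℝ := MeasurableEquiv.subLeft (p + m / 2) with he
  have heap : ∀ u, e u = p + m / 2 - u := fun u ↦ rfl
  set T₂ : Set ℝ := e '' S₂ with hT₂
  have hT₂m : MeasurableSet T₂ := e.measurableSet_image.2 hS₂m
  have hT₂0 : T₂ ⊆ Ioi 0 := by
    rintro _ ⟨u, hu, rfl⟩
    rw [heap]
    have := (hS₂sub hu).2
    show 0 < p + m / 2 - u
    linarith
  have hI₂ : ∫⁻ s in T₂, ENNReal.ofReal s⁻¹ ≤ ENNReal.ofReal (2 * π ^ 2 / L) := by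
    refine (Literature.Analysis.Complex.AnnulusCrossing.lintegral_inv_le_of_forall_crossing (c := 0) hf hinj
      hR₃ hR₃₄ hT₂m hT₂0 ?_).trans
      (ENNReal.ofReal_le_ofReal (div_le_div_of_nonneg_left (by positivity) hL hL₂))
    rintro _ ⟨u, hu, rfl⟩
    rw [heap]
    exact hcross₂ u hu
  -- `∫_{S₂} du/u ≤ (2p/m) ∫_{T₂} ds/s`
  have hpres : MeasurePreserving e volume volume :=
    Measure.measurePreserving_sub_left (volume : Measure ℝ) (p + m / 2)
  have hI₂' : ∫⁻ u in S₂, ENNReal.ofReal u⁻¹ ≤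
      ENNReal.ofReal (2 * p / m) * ENNReal.ofReal (2 * π ^ 2 / L) := by
    calc ∫⁻ u in S₂, ENNReal.ofReal u⁻¹
        ≤ ∫⁻ u in S₂, ENNReal.ofReal (2 * p / m) * ENNReal.ofReal (e u)⁻¹ := by
          refine setLIntegral_mono' hS₂m fun u hu ↦ ?_
          have hu1 := (hS₂sub hu).1
          have hu2 := (hS₂sub hu).2
          have hu0 : 0 < u := (half_pos hm).trans hu1
          have hpu : 0 < p + m / 2 - u := by linarith
          rw [heap, ← ENNReal.ofReal_mul (by positivity)]
          refine ENNReal.ofReal_le_ofReal ?_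
          have h1 : u⁻¹ ≤ 2 / m := by
            rw [inv_le_comm₀ hu0 (by positivity), inv_div]
            linarith
          have h3 : 1 ≤ p * (p + m / 2 - u)⁻¹ := by
            rw [← div_eq_mul_inv, one_le_div hpu]
            linarith
          calc u⁻¹ ≤ 2 / m := h1
            _ = 2 / m * 1 := (mul_one _).symm
            _ ≤ 2 / m * (p * (p + m / 2 - u)⁻¹) := by gcongr
            _ = 2 * p / m * (p + m / 2 - u)⁻¹ := by ring
      _ = ENNReal.ofReal (2 * p / m) * ∫⁻ u in S₂, ENNReal.ofReal (e u)⁻¹ :=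
          lintegral_const_mul' _ _ ENNReal.ofReal_ne_top
      _ = ENNReal.ofReal (2 * p / m) * ∫⁻ s in T₂, ENNReal.ofReal s⁻¹ := by
          congr 1
          have h := hpres.setLIntegral_comp_preimage_emb e.measurableEmbedding
            (fun s ↦ ENNReal.ofReal s⁻¹) T₂
          rw [hT₂, e.injective.preimage_image] at h
          exact h
      _ ≤ ENNReal.ofReal (2 * p / m) * ENNReal.ofReal (2 * π ^ 2 / L) :=
          mul_le_mul_right hI₂ _
  -- the two kinds cover `(m/2, m)`, of logarithmic measure `log 2`
  have hcover : Ioo (m / 2) m ⊆ S₁ ∪ S₂ := fun u hu ↦ by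
    by_cases h : u ∈ S₁
    · exact Or.inl h
    · exact Or.inr ⟨hu, h⟩
  have hlog2 : ENNReal.ofReal (Real.log 2) ≤
      ENNReal.ofReal (2 * π ^ 2 / L) + ENNReal.ofReal (2 * p / m) * ENNReal.ofReal (2 * π ^ 2 / L) := by
    have h1 : ∫⁻ u in Ioo (m / 2) m, ENNReal.ofReal u⁻¹ = ENNReal.ofReal (Real.log 2) := by
      rw [Literature.Analysis.Complex.AnnulusCrossing.lintegral_inv_Ioo (half_pos hm) (by linarith)]
      congr 2
      field_simp
    rw [← h1]
    calc ∫⁻ u in Ioo (m / 2) m, ENNReal.ofReal u⁻¹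
        ≤ ∫⁻ u in S₁ ∪ S₂, ENNReal.ofReal u⁻¹ := lintegral_mono_set hcover
      _ ≤ (∫⁻ u in S₁, ENNReal.ofReal u⁻¹) + ∫⁻ u in S₂, ENNReal.ofReal u⁻¹ :=
          lintegral_union_le _ _ _
      _ ≤ _ := add_le_add hI₁ hI₂'
  -- back to real numbers
  rw [← ENNReal.ofReal_mul (by positivity), ← ENNReal.ofReal_add (by positivity) (by positivity),
    ENNReal.ofReal_le_ofReal_iff (by positivity)] at hlog2
  have hkey : Real.log 2 ≤ 2 * π ^ 2 / L * (1 + 2 * p / m) := by linarith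
  rw [div_mul_eq_mul_div, le_div_iff₀ hL] at hkey
  have h3 : Real.log 2 * L * m ≤ 2 * π ^ 2 * (1 + 2 * p / m) * m :=
    mul_le_mul_of_nonneg_right hkey hm.le
  have h4 : 2 * π ^ 2 * (1 + 2 * p / m) * m = 2 * π ^ 2 * (m + 2 * p) := by
    field_simp
  linarith [h3, h4]

end LengthArea

namespace Loewner

variable {W : ℝ≥0 → ℝ}

/-! ### The exit point `z₀` of the closed hull at an exit time -/

/-- **The exit point.** At an exit time `t = T(r)` of the disc `r𝕌` the closed hull `K̂_t` has
a point of modulus `≥ r`; we take one of maximal modulus ([LSW] proof of Lemma 6.2: "let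
`r' = sup{|z| : z ∈ K_T}` … and let `z₀ ∈ K_T` be such that `|z₀| = r'`"). (For `s ↓ t` the
hulls `K̂_s ⊄ r𝕌` decrease to `⋂_{s>t} K̂_s = K̂_t`; compactness.)
[cite: LawlerSchrammWerner2003Restriction, proof of Lemma 6.2] -/
theorem exists_exitPoint (hW : Continuous W) {r : ℝ} {t : ℝ≥0} (hex : IsExitTime W r t) :
    ∃ z₀ ∈ closedHull W t, r ≤ ‖z₀‖ ∧ ∀ z ∈ closedHull W t, ‖z‖ ≤ ‖z₀‖ := by
  have hcpt := isCompact_closedHull hW t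
  have hne : (closedHull W t).Nonempty :=
    ⟨(W 0 : ℂ), show 0 ≤ ((W 0 : ℝ) : ℂ).im by simp, (swallowingTime_driving_le W).trans bot_le⟩
  obtain ⟨z₀, hz₀, hmax⟩ := hcpt.exists_isMaxOn hne continuous_norm.continuousOn
  refine ⟨z₀, hz₀, ?_, fun z hz ↦ hmax hz⟩
  -- points of `K̂_{t + 1/(n+1)}` outside the disc
  set sq : ℕ → ℝ≥0 := fun n ↦ t + ⟨1 / ((n : ℝ) + 1), by positivity⟩ with hsq
  have hsqcoe : ∀ n, ((sq n : ℝ≥0) : ℝ) = t + 1 / ((n : ℝ) + 1) := fun n ↦ by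
    simp only [hsq, NNReal.coe_add]
    rfl
  have hpoke : ∀ n, ∃ z ∈ closedHull W (sq n), r ≤ ‖z‖ := by
    intro n
    have hlt : t < sq n :=
      lt_add_of_pos_right _ (by change (0 : ℝ) < 1 / ((n : ℝ) + 1); positivity)
    have h := hex.2 (sq n) hlt
    rw [not_subset] at h
    obtain ⟨z, hz, hzr⟩ := h
    rw [mem_ball, dist_zero_right, not_lt] at hzr
    exact ⟨z, hz, hzr⟩
  choose zs hzs hrzs using hpoke
  have hsq_le : ∀ n, sq n ≤ t + 1 := fun n ↦ by
    rw [← NNReal.coe_le_coe, hsqcoe, NNReal.coe_add, NNReal.coe_one]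
    have : 1 / ((n : ℝ) + 1) ≤ 1 := by
      rw [div_le_one (by positivity)]
      linarith [n.cast_nonneg (α := ℝ)]
    linarith
  have hmem : ∀ n, zs n ∈ closedHull W (t + 1) := fun n ↦ closedHull_mono W (hsq_le n) (hzs n)
  obtain ⟨z, -, φ, hφ, hlim⟩ := (isCompact_closedHull hW (t + 1)).tendsto_subseq hmem
  -- `z ∈ K̂_s` for every `s > t`
  have hsqlim : Tendsto (fun n ↦ ((sq (φ n) : ℝ≥0) : ℝ)) atTop (𝓝 (t : ℝ)) := by
    have h : Tendsto (fun n : ℕ ↦ (t : ℝ) + 1 / ((n : ℝ) + 1)) atTop (𝓝 ((t : ℝ) + 0)) :=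
      tendsto_const_nhds.add tendsto_one_div_add_atTop_nhds_zero_nat
    rw [add_zero] at h
    have h' := h.comp hφ.tendsto_atTop
    refine h'.congr fun n ↦ ?_
    simp only [Function.comp_apply, hsqcoe]
  have hzs' : ∀ s : ℝ≥0, t < s → z ∈ closedHull W s := by
    intro s hts
    have hev : ∀ᶠ n in atTop, ((sq (φ n) : ℝ≥0) : ℝ) < s :=
      hsqlim (Iio_mem_nhds (by exact_mod_cast hts))
    refine (isClosed_closedHull hW s).mem_of_tendsto hlim ?_
    filter_upwards [hev] with n hn
    exact closedHull_mono W (le_of_lt (by exact_mod_cast hn)) (hzs (φ n))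
  -- hence `z ∈ K̂_t`
  have hzt : z ∈ closedHull W t := by
    refine ⟨(hzs' (t + 1) (lt_add_one t)).1, ?_⟩
    by_contra hgt
    rw [not_le] at hgt
    obtain ⟨m, htm, hmT⟩ := exists_between hgt
    obtain ⟨s, rfl⟩ := WithTop.ne_top_iff_exists.1 (ne_top_of_lt hmT)
    exact absurd (hzs' s (WithTop.coe_lt_coe.1 htm)).2 (not_le.2 hmT)
  have hrz : r ≤ ‖z‖ :=
    ge_of_tendsto (continuous_norm.continuousAt.tendsto.comp hlim)
      (Eventually.of_forall fun n ↦ hrzs (φ n))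
  exact hrz.trans (hmax hzt)

/-- The exit point is swallowed exactly at the exit time: `T_{z₀} = t` (it lies in `K̂_t` and,
having modulus `≥ r`, in no `K̂_s ⊆ r𝕌`, `s < t`) — "`z₀ ∈ K_T ∖ ⋃_{t<T} K_t`".
[cite: LawlerSchrammWerner2003Restriction, proof of Lemma 6.2] -/
theorem swallowingTime_exitPoint {r : ℝ} {t : ℝ≥0} (hex : IsExitTime W r t) {z₀ : ℂ}
    (hz₀ : z₀ ∈ closedHull W t) (hr : r ≤ ‖z₀‖) : swallowingTime W z₀ = t := by
  refine le_antisymm hz₀.2 ?_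
  by_contra hlt
  rw [not_le] at hlt
  obtain ⟨s, hs⟩ := WithTop.ne_top_iff_exists.1 (ne_top_of_lt hlt)
  rw [← hs] at hlt
  have hst : s < t := WithTop.coe_lt_coe.1 hlt
  have hmem : z₀ ∈ closedHull W s := ⟨hz₀.1, by rw [← hs]⟩
  have := hex.1 s hst hmem
  rw [mem_ball, dist_zero_right] at this
  exact absurd hr (not_le.2 this)

/-- The vertical ray above a point of `K̂_t` of maximal modulus lies in the Loewner domain `H_t`
(its points have larger modulus). This is the path `β(s) = z₀ + (1 - s)i` of [LSW].
[cite: LawlerSchrammWerner2003Restriction, proof of Lemma 6.2] -/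
theorem add_mul_I_mem_domain_of_max {t : ℝ≥0} {z₀ : ℂ} (him : 0 ≤ z₀.im)
    (hmax : ∀ z ∈ closedHull W t, ‖z‖ ≤ ‖z₀‖) {y : ℝ} (hy : 0 < y) :
    z₀ + y * I ∈ domain W t := by
  rw [mem_domain_iff]
  have hyim : (z₀ + y * I).im = z₀.im + y := by simp
  have hyre : (z₀ + y * I).re = z₀.re := by simp
  refine ⟨show 0 < (z₀ + y * I).im by rw [hyim]; linarith, ?_⟩
  by_contra hle
  rw [not_lt] at hle
  have hmem : z₀ + y * I ∈ closedHull W t := ⟨by rw [hyim]; linarith, hle⟩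
  have h := hmax _ hmem
  have hlt : ‖z₀‖ ^ 2 < ‖z₀ + y * I‖ ^ 2 := by
    rw [Complex.sq_norm, Complex.sq_norm, Complex.normSq_apply, Complex.normSq_apply, hyim, hyre]
    nlinarith
  nlinarith [norm_nonneg z₀, norm_nonneg (z₀ + y * I)]

/-! ### The key limit: `g_t(z₀ + iy) → W_t` as `y ↓ 0` -/

/-- Near a finite swallowing time the flow comes close to the driving function at times
arbitrarily close to it: if `T_z = t > 0` then for every `δ > 0` and `s₁ < t` some
`s ∈ (s₁, t)` has `|g_s(z) - W_s| < δ` (the flow is bounded away from `W` on the compact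
`[0, s₁]`, `IsSolution.exists_le_norm_sub`, and `inf_{s<t} |g_s z - W_s| = 0`,
`IsSolution.exists_norm_sub_lt`). Lawler (2005), Ch. 4 §4.1 ("`T_z` is the first time
`g_t(z) - W_t` hits `0`"). [cite: Lawler2005, Ch. 4 §4.1] -/
theorem exists_norm_map_sub_driving_lt_near (hW : Continuous W) {z : ℂ} {t : ℝ≥0} (ht : 0 < t)
    (hT : swallowingTime W z = t) {δ : ℝ} (hδ : 0 < δ) {s₁ : ℝ≥0} (hs₁ : s₁ < t) :
    ∃ s : ℝ≥0, s₁ < s ∧ s < t ∧ ‖map W s z - W s‖ < δ := by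
  have hz0 : z ≠ W 0 := by
    intro h
    have := swallowingTime_driving_le W
    rw [← h, hT] at this
    exact absurd this (not_le.2 (by exact_mod_cast ht))
  obtain ⟨g, hg⟩ := exists_isSolution_swallowingTime_holds hW hz0
  rw [hT] at hg
  obtain ⟨δ₁, hδ₁, hfar⟩ := hg.exists_le_norm_sub hW s₁.coe_nonneg (b := s₁)
    (by rw [Real.toNNReal_coe]; exact_mod_cast hs₁)
  obtain ⟨s, hs0, hst, hlt⟩ := hg.exists_norm_sub_lt hW ht hT (δ := min δ δ₁) (lt_min hδ hδ₁)
  have hs₁s : (s₁ : ℝ) < s := by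
    by_contra hle
    rw [not_lt] at hle
    have := hfar s ⟨hs0, hle⟩
    linarith [min_le_right δ (δ₁ : ℝ)]
  have hscoe : ((s.toNNReal : ℝ≥0) : ℝ) = s := Real.coe_toNNReal _ hs0
  refine ⟨s.toNNReal, ?_, ?_, ?_⟩
  · rw [← NNReal.coe_lt_coe, hscoe]; exact hs₁s
  · rw [← NNReal.coe_lt_coe, hscoe]; exact hst
  · have hsT : ((s.toNNReal : ℝ≥0) : WithTop ℝ≥0) < (t : WithTop ℝ≥0) := by
      rw [WithTop.coe_lt_coe, ← NNReal.coe_lt_coe, hscoe]; exact hst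
    rw [map_eq_of_isSolution hW hg hsT, hscoe]
    exact lt_of_lt_of_le hlt (min_le_left _ _)

/-- **The Loewner map at the exit time lands at the driving point along the vertical above the
exit point**: if `T_{z₀} = t > 0` and the vertical ray `z₀ + iy`, `y > 0`, lies in `H_t`, then
`g_t(z₀ + iy) → W_t` as `y ↓ 0` — the step "the limit `w := lim_{s ↗ 1} g_T ∘ β(s)` exists …
Moreover, since `β(1) = z₀`, we must have `w = W`" of [LSW], proved here without boundary
behaviour of conformal maps: write `g_t = g^{(s)}_{t-s} ∘ g_s` (cocycle, `map_add`) with `s < t`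
close to `t` chosen so that `|g_s(z₀) - W_s|` is small (`exists_norm_map_sub_driving_lt_near`);
the map `g^{(s)}_{t-s}` of the chain driven by `W(s + ·)` moves points by
`O(osc_{[s,t]} W + √(t-s))` (`norm_map_sub_self_le_of_mem_domain`), and `g_s` is continuous at
`z₀`. [cite: LawlerSchrammWerner2003Restriction, proof of Lemma 6.2] -/
theorem norm_map_sub_driving_lt_of_vertical (hW : Continuous W) {z₀ : ℂ} {t : ℝ≥0} (ht : 0 < t)
    (hT : swallowingTime W z₀ = t) (hdom : ∀ y : ℝ, 0 < y → z₀ + y * I ∈ domain W t)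
    {η : ℝ} (hη : 0 < η) :
    ∃ y₀ > 0, ∀ y : ℝ, 0 < y → y ≤ y₀ → ‖map W t (z₀ + y * I) - W t‖ < η := by
  -- continuity of `W` at `t`
  obtain ⟨θ, hθ, hWθ⟩ := Metric.continuous_iff.1 hW t (η / 60) (by positivity)
  have ht' : (0 : ℝ) < t := ht
  set τ : ℝ := min ((t : ℝ) / 2) (min (θ / 2) ((η / 60) ^ 2)) with hτ
  have hτpos : 0 < τ := by positivity
  have hτt : τ < t := (min_le_left _ _).trans_lt (by linarith)
  have hτθ : τ < θ := ((min_le_right _ _).trans (min_le_left _ _)).trans_lt (by linarith)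
  have hτη : τ ≤ (η / 60) ^ 2 := (min_le_right _ _).trans (min_le_right _ _)
  set s₁ : ℝ≥0 := ⟨(t : ℝ) - τ, by linarith⟩ with hs₁
  have hs₁coe : (s₁ : ℝ) = t - τ := rfl
  have hs₁t : s₁ < t := by
    rw [← NNReal.coe_lt_coe, hs₁coe]; linarith
  obtain ⟨s, hs₁s, hst, hclose⟩ :=
    exists_norm_map_sub_driving_lt_near hW ht hT (δ := η / 4) (by positivity) hs₁t
  set u : ℝ≥0 := t - s with hu
  have hsu : s + u = t := add_tsub_cancel_of_le hst.le
  have hucoe : (u : ℝ) = t - s := by rw [hu, NNReal.coe_sub hst.le]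
  have huτ : (u : ℝ) < τ := by
    have : (s₁ : ℝ) < s := hs₁s
    rw [hs₁coe] at this
    rw [hucoe]; linarith
  -- continuity of `g_s` at `z₀`
  have hsT : (s : WithTop ℝ≥0) < swallowingTime W z₀ := by rw [hT]; exact_mod_cast hst
  obtain ⟨ρ, hρ, hball⟩ := Metric.continuousAt_iff.1 (continuousAt_map hW hsT) (η / 4)
    (by positivity)
  refine ⟨ρ / 2, by positivity, fun y hy hyρ ↦ ?_⟩
  set V : ℂ := z₀ + y * I with hV
  have hVt : V ∈ domain W t := hdom y hy
  have hVT : ((s + u : ℝ≥0) : WithTop ℝ≥0) < swallowingTime W V := by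
    rw [hsu]; exact ((mem_domain_iff W t V).1 hVt).2
  obtain ⟨huT, hcoc⟩ := map_add hW hVT
  rw [hsu] at hcoc
  -- the shifted chain moves points little
  have hM : ∀ v ∈ Icc (0 : ℝ) u,
      ‖(((fun u' ↦ W (s + u')) v.toNNReal : ℝ) : ℂ) - (W t : ℂ)‖ ≤ η / 60 := by
    intro v hv
    have hvu : v.toNNReal ≤ u := by
      rw [← NNReal.coe_le_coe, Real.coe_toNNReal _ hv.1]; exact hv.2
    have h1 : dist (s + v.toNNReal) t < θ := by
      rw [NNReal.dist_eq, abs_sub_comm, abs_of_nonneg, NNReal.coe_add]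
      · have : ((v.toNNReal : ℝ≥0) : ℝ) ≤ u := hvu
        rw [hucoe] at this
        have h0 : (0 : ℝ) ≤ v.toNNReal := (v.toNNReal).coe_nonneg
        linarith
      · rw [sub_nonneg, NNReal.coe_le_coe, ← hsu]
        exact add_le_add le_rfl hvu
    have := hWθ _ h1
    rw [Real.dist_eq] at this
    rw [← ofReal_sub, Complex.norm_real, Real.norm_eq_abs]
    exact this.le
  have hVs : V ∈ domain W s := by
    rw [mem_domain_iff] at hVt ⊢
    exact ⟨hVt.1, lt_of_le_of_lt (by exact_mod_cast hst.le) hVt.2⟩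
  have hw : map W s V ∈ domain (fun u' ↦ W (s + u')) u :=
    (mem_domain_iff _ _ _).2 ⟨mapsTo_map hW s hVs, huT⟩
  have hdisp := norm_map_sub_self_le_of_mem_domain (continuous_shift W hW s) hM hw
  have hsqrt : Real.sqrt u < η / 60 := by
    rw [Real.sqrt_lt' (by positivity)]
    exact huτ.trans_le hτη
  -- `|W s - W t| < η/60`
  have hWst : ‖(W s : ℂ) - W t‖ < η / 60 := by
    have h1 : dist s t < θ := by
      rw [NNReal.dist_eq, abs_sub_comm, abs_of_nonneg (by rw [sub_nonneg]; exact_mod_cast hst.le)]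
      rw [← hucoe]; linarith
    have := hWθ _ h1
    rw [Real.dist_eq] at this
    rw [← ofReal_sub, Complex.norm_real, Real.norm_eq_abs]
    exact this
  -- continuity term
  have hcontV : ‖map W s V - map W s z₀‖ < η / 4 := by
    have : dist V z₀ < ρ := by
      rw [dist_eq_norm, hV, add_sub_cancel_left, norm_mul, Complex.norm_real, norm_I, mul_one,
        Real.norm_eq_abs, abs_of_pos hy]
      linarith
    have := hball this
    rwa [dist_eq_norm] at this
  -- assemble
  have hsplit : map W t V - W t =
      (map (fun u' ↦ W (s + u')) u (map W s V) - map W s V) + (map W s V - map W s z₀) +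
        (map W s z₀ - W s) + ((W s : ℂ) - W t) := by
    rw [hcoc]; ring
  calc ‖map W t V - W t‖
      ≤ ‖map (fun u' ↦ W (s + u')) u (map W s V) - map W s V‖ + ‖map W s V - map W s z₀‖ +
          ‖map W s z₀ - W s‖ + ‖(W s : ℂ) - W t‖ := by
        rw [hsplit]
        refine (norm_add_le _ _).trans (add_le_add ?_ le_rfl)
        refine (norm_add_le _ _).trans (add_le_add ?_ le_rfl)
        exact norm_add_le _ _
    _ < (2 * (η / 60) + 13 * (η / 60)) + η / 4 + η / 4 + η / 60 := by
        have h1 : ‖map (fun u' ↦ W (s + u')) u (map W s V) - map W s V‖ <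
            2 * (η / 60) + 13 * (η / 60) := by
          refine hdisp.trans_lt ?_
          linarith
        linarith
    _ ≤ η := by linarith

/-- **Far points on every circle about the driving point.** Under the hypotheses of
`norm_map_sub_driving_lt_of_vertical`, for every `ρ > 0` some point `z₀ + iy`, `y > 0`, of the
vertical ray is mapped by `g_t` to the circle of radius `ρ` about `W_t` (the image of the ray
is connected, accumulates at `W_t` and is unbounded — `|g_t(z) - z|` is bounded on `H_t`,
`norm_map_sub_self_le_of_mem_domain`). So every semicircle about `W_t` contains a point whose
`g_t`-preimage has modulus `> |z₀| ≥ r`: the topological content of "the extremal length in `ℍ`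
between `Ã` and `(-∞, W]` goes to infinity as well" in [LSW].
[cite: LawlerSchrammWerner2003Restriction, proof of Lemma 6.2] -/
theorem exists_norm_map_vertical_sub_driving_eq (hW : Continuous W) {z₀ : ℂ} {t : ℝ≥0}
    (hdom : ∀ y : ℝ, 0 < y → z₀ + y * I ∈ domain W t)
    (hlim : ∀ η : ℝ, 0 < η → ∃ y₀ > 0, ∀ y : ℝ, 0 < y → y ≤ y₀ → ‖map W t (z₀ + y * I) - W t‖ < η)
    {ρ : ℝ} (hρ : 0 < ρ) :
    ∃ y : ℝ, 0 < y ∧ ‖map W t (z₀ + y * I) - W t‖ = ρ := by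
  set φ : ℝ → ℝ := fun y ↦ ‖map W t (z₀ + y * I) - W t‖ with hφ
  have hφc : ∀ y, 0 < y → ContinuousAt φ y := fun y hy ↦ by
    have h1 : ContinuousAt (fun y : ℝ ↦ z₀ + y * I) y := by fun_prop
    have h2 : ContinuousAt (map W t) (z₀ + y * I) :=
      continuousAt_map hW ((mem_domain_iff _ _ _).1 (hdom y hy)).2
    have h3 : ContinuousAt (fun y : ℝ ↦ map W t (z₀ + y * I)) y :=
      ContinuousAt.comp (f := fun y : ℝ ↦ z₀ + y * I) h2 h1
    exact (h3.sub continuousAt_const).norm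
  obtain ⟨y₁, hy₁, hsmall⟩ := hlim ρ hρ
  have hφ₁ : φ y₁ < ρ := hsmall y₁ hy₁ le_rfl
  obtain ⟨M, -, hM⟩ := exists_forall_norm_driving_sub_le hW t 0
  set C : ℝ := 2 * M + 13 * Real.sqrt t with hC
  set y₂ : ℝ := max (y₁ + 1) (‖z₀‖ + ‖(W t : ℂ)‖ + C + ρ + 1) with hy₂
  have hy₁₂ : y₁ < y₂ := lt_of_lt_of_le (lt_add_one _) (le_max_left _ _)
  have hy₂pos : 0 < y₂ := hy₁.trans hy₁₂
  have hφ₂ : ρ < φ y₂ := by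
    have hdisp := norm_map_sub_self_le_of_mem_domain hW hM (hdom y₂ hy₂pos)
    set V : ℂ := z₀ + y₂ * I with hV
    have hVn : y₂ - ‖z₀‖ ≤ ‖V‖ := by
      have h1 : ‖(y₂ : ℂ) * I‖ = y₂ := by
        rw [norm_mul, Complex.norm_real, norm_I, mul_one, Real.norm_eq_abs, abs_of_pos hy₂pos]
      have h2 := norm_sub_norm_le ((y₂ : ℂ) * I) (-z₀)
      rw [h1, norm_neg, sub_neg_eq_add, add_comm _ z₀] at h2
      linarith [abs_le.1 (abs_norm_sub_norm_le ((y₂ : ℂ) * I) (-z₀))]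
    have h3 : ‖V‖ - ‖(W t : ℂ)‖ - C ≤ φ y₂ := by
      have h4 : ‖V - W t‖ ≤ ‖map W t V - W t‖ + ‖map W t V - V‖ := by
        have := norm_sub_le (map W t V - W t) (map W t V - V)
        rwa [show map W t V - ↑(W t) - (map W t V - V) = V - W t by ring] at this
      have h5 : ‖V‖ - ‖(W t : ℂ)‖ ≤ ‖V - W t‖ := norm_sub_norm_le _ _
      show ‖V‖ - ‖(W t : ℂ)‖ - C ≤ ‖map W t V - W t‖
      linarith
    have h6 : ‖z₀‖ + ‖(W t : ℂ)‖ + C + ρ + 1 ≤ y₂ := le_max_right _ _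
    linarith
  have hcont : ContinuousOn φ (Icc y₁ y₂) := fun y hy ↦
    (hφc y (hy₁.trans_le hy.1)).continuousWithinAt
  obtain ⟨y, hy, hyρ⟩ := intermediate_value_Icc hy₁₂.le hcont ⟨hφ₁.le, hφ₂.le⟩
  exact ⟨y, hy₁.trans_le hy.1, hyρ⟩

/-! ### Real points still flowing to the right of the driving point -/

/-- The real flow is monotone: `W_0 < x ≤ x'` flowing ⇒ `re g_t x ≤ re g_t x'`. [folklore] -/
theorem map_ofReal_re_le_of_le (hW : Continuous W) {x x' : ℝ} (hx : W 0 < x) (hxx' : x ≤ x')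
    {t : ℝ≥0} (ht : (t : WithTop ℝ≥0) < swallowingTime W x)
    (ht' : (t : WithTop ℝ≥0) < swallowingTime W x') : (map W t x).re ≤ (map W t x').re := by
  rcases hxx'.eq_or_lt with rfl | hlt
  · exact le_rfl
  · exact (map_ofReal_re_lt_of_lt hW hx hlt ht ht').le

/-! ### Interior points of the image on a given circle -/

/-- **An interior point on a circle through the image of a real point.** Let `W_0 < a₀ < x` be
real points flowing at time `t` with `re g_t x = re g_t a₀ + u`. Then the circle of radius `u`
about `g_t a₀` contains a point `w ∈ ℍ` (not merely the real point `g_t x`) whose preimage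
`f_t w ∈ H_t` is as close to `x` as we please: `g_t` is continuous on the open set of flowing
points and increasing on the flowing reals, so along a short horizontal segment at small height
over `[x - ε', x + ε']` the distance `|g_t - g_t a₀|` passes through the value `u`
(intermediate value theorem). This replaces boundary values of `f_t = g_t⁻¹` in the proof of
[LSW] Lemma 6.2. [cite: LawlerSchrammWerner2003Restriction, proof of Lemma 6.2] -/
theorem exists_mem_sphere_of_ofReal (hW : Continuous W) {t : ℝ≥0} {a₀ x : ℝ} (ha₀ : W 0 < a₀)
    (hax : a₀ < x) (ha₀T : (t : WithTop ℝ≥0) < swallowingTime W a₀)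
    (hxT : (t : WithTop ℝ≥0) < swallowingTime W x) {u : ℝ}
    (hu : (map W t x).re = (map W t a₀).re + u) {R : ℝ} (hxR : ‖(x : ℂ)‖ < R) :
    ∃ w : ℂ, 0 < w.im ∧ ‖w - ((map W t a₀).re : ℝ)‖ = u ∧ ‖loewnerInv W t w‖ < R := by
  set c₁ : ℝ := (map W t a₀).re with hc₁
  have hUo : IsOpen {z : ℂ | (t : WithTop ℝ≥0) < swallowingTime W z} :=
    isOpen_setOf_lt_swallowingTime hW t
  obtain ⟨ρ₀, hρ₀, hball⟩ := Metric.isOpen_iff.1 hUo x hxT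
  set ε' : ℝ := min (ρ₀ / 4) (min ((x - a₀) / 2) ((R - ‖(x : ℂ)‖) / 4)) with hε'
  have hε'pos : 0 < ε' := by
    have : 0 < R - ‖(x : ℂ)‖ := by linarith
    positivity
  have hε'ρ : ε' ≤ ρ₀ / 4 := min_le_left _ _
  have hε'a : ε' ≤ (x - a₀) / 2 := (min_le_right _ _).trans (min_le_left _ _)
  have hε'R : ε' ≤ (R - ‖(x : ℂ)‖) / 4 := (min_le_right _ _).trans (min_le_right _ _)
  have hflow : ∀ z : ℂ, dist z x < ρ₀ → (t : WithTop ℝ≥0) < swallowingTime W z :=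
    fun z hz ↦ hball hz
  -- the real points `x ± ε'`
  have hdistL : dist (((x - ε' : ℝ)) : ℂ) x < ρ₀ := by
    rw [dist_eq_norm, ← ofReal_sub, Complex.norm_real, Real.norm_eq_abs,
      show x - ε' - x = -ε' by ring, abs_neg, abs_of_pos hε'pos]
    linarith
  have hdistR : dist (((x + ε' : ℝ)) : ℂ) x < ρ₀ := by
    rw [dist_eq_norm, ← ofReal_sub, Complex.norm_real, Real.norm_eq_abs,
      show x + ε' - x = ε' by ring, abs_of_pos hε'pos]
    linarith
  have hLT := hflow _ hdistL
  have hRT := hflow _ hdistR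
  have hxL : W 0 < x - ε' := by linarith
  have hx0 : W 0 < x := ha₀.trans hax
  set gL : ℝ := (map W t ((x - ε' : ℝ) : ℂ)).re with hgL
  set gR : ℝ := (map W t ((x + ε' : ℝ) : ℂ)).re with hgR
  have h1 : gL < c₁ + u := by
    rw [hc₁, ← hu]; exact map_ofReal_re_lt_of_lt hW hxL (by linarith) hLT hxT
  have h1' : c₁ < gL := map_ofReal_re_lt_of_lt hW ha₀ (by linarith) ha₀T hLT
  have h2 : c₁ + u < gR := by
    rw [hc₁, ← hu]; exact map_ofReal_re_lt_of_lt hW hx0 (by linarith) hxT hRT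
  have hmapL : map W t ((x - ε' : ℝ) : ℂ) = (gL : ℂ) := map_ofReal_eq hW hLT
  have hmapR : map W t ((x + ε' : ℝ) : ℂ) = (gR : ℂ) := map_ofReal_eq hW hRT
  -- continuity of `g_t` at `x ± ε'`
  obtain ⟨η₁, hη₁, hη₁b⟩ := Metric.continuousAt_iff.1 (continuousAt_map hW hLT) (c₁ + u - gL)
    (by linarith)
  obtain ⟨η₂, hη₂, hη₂b⟩ := Metric.continuousAt_iff.1 (continuousAt_map hW hRT) (gR - (c₁ + u))
    (by linarith)
  set η : ℝ := min (min η₁ η₂ / 2) ε' with hη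
  have hηpos : 0 < η := by positivity
  have hηε : η ≤ ε' := min_le_right _ _
  have hη₁' : η < η₁ := (min_le_left _ _).trans_lt (by
    have := min_le_left η₁ η₂; linarith)
  have hη₂' : η < η₂ := (min_le_left _ _).trans_lt (by
    have := min_le_right η₁ η₂; linarith)
  -- the horizontal segment at height `η`
  set seg : ℝ → ℂ := fun τ ↦ ((x + τ : ℝ) : ℂ) + η * I with hseg
  have hsegc : Continuous seg := by
    simp only [hseg]; fun_prop
  have hseg_im : ∀ τ, (seg τ).im = η := fun τ ↦ by simp [hseg]
  have hseg_dist : ∀ τ, dist (seg τ) x ≤ |τ| + η := fun τ ↦ by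
    rw [dist_eq_norm, hseg, show ((x + τ : ℝ) : ℂ) + η * I - x = (τ : ℂ) + η * I by push_cast; ring]
    refine (norm_add_le _ _).trans ?_
    rw [Complex.norm_real, Real.norm_eq_abs, norm_mul, Complex.norm_real, norm_I, mul_one,
      Real.norm_eq_abs, abs_of_pos hηpos]
  have hsegT : ∀ τ ∈ Icc (-ε') ε', (t : WithTop ℝ≥0) < swallowingTime W (seg τ) := by
    intro τ hτ
    refine hflow _ ((hseg_dist τ).trans_lt ?_)
    have : |τ| ≤ ε' := abs_le.2 ⟨hτ.1, hτ.2⟩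
    linarith
  have hsegdom : ∀ τ ∈ Icc (-ε') ε', seg τ ∈ domain W t := fun τ hτ ↦
    (mem_domain_iff _ _ _).2 ⟨show 0 < (seg τ).im by rw [hseg_im]; exact hηpos, hsegT τ hτ⟩
  set ψ : ℝ → ℝ := fun τ ↦ ‖map W t (seg τ) - c₁‖ with hψ
  have hψc : ContinuousOn ψ (Icc (-ε') ε') := by
    intro τ hτ
    have h3 : ContinuousAt (fun τ : ℝ ↦ map W t (seg τ)) τ :=
      ContinuousAt.comp (f := seg) (continuousAt_map hW (hsegT τ hτ)) hsegc.continuousAt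
    exact ((h3.sub continuousAt_const).norm).continuousWithinAt
  -- values at the endpoints
  have hψL : ψ (-ε') < u := by
    have hd : dist (seg (-ε')) ((x - ε' : ℝ) : ℂ) < η₁ := by
      rw [dist_eq_norm, hseg, show ((x + -ε' : ℝ) : ℂ) + η * I - ((x - ε' : ℝ) : ℂ) = η * I by
        push_cast; ring, norm_mul, Complex.norm_real, norm_I, mul_one, Real.norm_eq_abs,
        abs_of_pos hηpos]
      exact hη₁'
    have h := hη₁b hd
    rw [dist_eq_norm, hmapL] at h
    have hreal : ‖(gL : ℂ) - c₁‖ = gL - c₁ := by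
      rw [← ofReal_sub, Complex.norm_real, Real.norm_eq_abs, abs_of_pos (by linarith)]
    calc ψ (-ε') = ‖(map W t (seg (-ε')) - gL) + ((gL : ℂ) - c₁)‖ := by
          simp only [hψ, sub_add_sub_cancel]
      _ ≤ ‖map W t (seg (-ε')) - gL‖ + ‖(gL : ℂ) - c₁‖ := norm_add_le _ _
      _ < (c₁ + u - gL) + (gL - c₁) := by rw [hreal]; linarith
      _ = u := by ring
  have hψR : u < ψ ε' := by
    have hd : dist (seg ε') ((x + ε' : ℝ) : ℂ) < η₂ := by
      rw [dist_eq_norm, hseg, show ((x + ε' : ℝ) : ℂ) + η * I - ((x + ε' : ℝ) : ℂ) = η * I by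
        ring, norm_mul, Complex.norm_real, norm_I, mul_one, Real.norm_eq_abs, abs_of_pos hηpos]
      exact hη₂'
    have h := hη₂b hd
    rw [dist_eq_norm, hmapR] at h
    have hreal : ‖(gR : ℂ) - c₁‖ = gR - c₁ := by
      rw [← ofReal_sub, Complex.norm_real, Real.norm_eq_abs, abs_of_pos (by linarith)]
    have h4 : ‖(gR : ℂ) - c₁‖ ≤ ‖map W t (seg ε') - c₁‖ + ‖map W t (seg ε') - gR‖ := by
      have := norm_sub_le (map W t (seg ε') - c₁) (map W t (seg ε') - gR)
      rwa [show map W t (seg ε') - ↑c₁ - (map W t (seg ε') - ↑gR) = (gR : ℂ) - c₁ by ring] at this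
    show u < ‖map W t (seg ε') - c₁‖
    linarith
  obtain ⟨τ, hτ, hτu⟩ := intermediate_value_Icc (by linarith : -ε' ≤ ε') hψc ⟨hψL.le, hψR.le⟩
  refine ⟨map W t (seg τ), mapsTo_map hW t (hsegdom τ hτ), hτu, ?_⟩
  rw [loewnerInv_map hW (hsegdom τ hτ)]
  have h5 : ‖seg τ‖ ≤ ‖(x : ℂ)‖ + (|τ| + η) := by
    have := hseg_dist τ
    rw [dist_eq_norm] at this
    linarith [norm_le_norm_add_norm_sub' (seg τ) (x : ℂ), norm_sub_rev (seg τ) (x : ℂ)]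
  have h6 : |τ| ≤ ε' := abs_le.2 ⟨hτ.1, hτ.2⟩
  linarith

/-! ### Elementary geometry: points of `ℍ` on circles about real centres -/

/-- A point strictly above a horizontal line through the centre lies on the open upper
semicircle: `w = circleMap c |w - c| θ` with `θ = arg (w - c) ∈ (0, π)`. [folklore] -/
theorem exists_circleMap_eq_of_im_lt {c w : ℂ} (hw : c.im < w.im) :
    ∃ θ ∈ Ioo (0 : ℝ) π, circleMap c ‖w - c‖ θ = w := by
  have him : 0 < (w - c).im := by rw [sub_im]; linarith
  refine ⟨arg (w - c), ⟨?_, ?_⟩, ?_⟩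
  · rcases (arg_nonneg_iff.2 him.le).eq_or_lt with h | h
    · exact absurd h.symm (fun h0 ↦ by rw [arg_eq_zero_iff] at h0; exact absurd h0.2 him.ne')
    · exact h
  · rcases (arg_le_pi (w - c)).eq_or_lt with h | h
    · rw [arg_eq_pi_iff] at h; exact absurd h.2 him.ne'
    · exact h
  · rw [circleMap, norm_mul_exp_arg_mul_I, add_sub_cancel]

/-- The two circles `|w - p| = u` and `|w| = q - u` meet in the OPEN upper half-plane when
`0 < p < q`, `q - p < 2u < p + q` (the triangle inequalities are strict). [folklore] -/
theorem exists_mem_inter_spheres {p q u : ℝ} (hp : 0 < p) (hpq : p < q) (hu₁ : q - p < 2 * u)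
    (hu₂ : 2 * u < p + q) :
    ∃ j : ℂ, 0 < j.im ∧ ‖j - p‖ = u ∧ ‖j‖ = q - u := by
  set x : ℝ := (p ^ 2 - u ^ 2 + (q - u) ^ 2) / (2 * p) with hx
  have h2px : 2 * p * x = p ^ 2 - u ^ 2 + (q - u) ^ 2 := by
    rw [hx]; field_simp
  have hA : 0 < q - u - x := by
    have : q - u - x = (q - p) * (2 * u + p - q) / (2 * p) := by
      rw [hx]; field_simp; ring
    rw [this]
    exact div_pos (mul_pos (by linarith) (by linarith)) (by linarith)
  have hB : 0 < q - u + x := by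
    have : q - u + x = (p + q - 2 * u) * (p + q) / (2 * p) := by
      rw [hx]; field_simp; ring
    rw [this]
    exact div_pos (mul_pos (by linarith) (by linarith)) (by linarith)
  have hysq : 0 < (q - u) ^ 2 - x ^ 2 := by
    have : (q - u) ^ 2 - x ^ 2 = (q - u - x) * (q - u + x) := by ring
    rw [this]; exact mul_pos hA hB
  have hqu : 0 < q - u := by linarith
  set y : ℝ := Real.sqrt ((q - u) ^ 2 - x ^ 2) with hy
  have hypos : 0 < y := Real.sqrt_pos.2 hysq
  have hy2 : y ^ 2 = (q - u) ^ 2 - x ^ 2 := Real.sq_sqrt hysq.le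
  refine ⟨⟨x, y⟩, hypos, ?_, ?_⟩
  · have hu0 : 0 < u := by linarith
    rw [← sq_eq_sq₀ (norm_nonneg _) hu0.le, Complex.sq_norm, Complex.normSq_apply]
    simp only [sub_re, ofReal_re, sub_im, ofReal_im, sub_zero]
    nlinarith [hy2, h2px]
  · rw [← sq_eq_sq₀ (norm_nonneg _) hqu.le, Complex.sq_norm, Complex.normSq_apply]
    simp only
    nlinarith [hy2]

/-- Moving a point of `ℍ̄` straight up increases its modulus. [folklore] -/
theorem norm_lt_norm_add_mul_I {z : ℂ} (hz : 0 ≤ z.im) {y : ℝ} (hy : 0 < y) : ‖z‖ < ‖z + y * I‖ := by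
  have hyim : (z + y * I).im = z.im + y := by simp
  have hyre : (z + y * I).re = z.re := by simp
  have hlt : ‖z‖ ^ 2 < ‖z + y * I‖ ^ 2 := by
    rw [Complex.sq_norm, Complex.sq_norm, Complex.normSq_apply, Complex.normSq_apply, hyim, hyre]
    nlinarith
  nlinarith [norm_nonneg z, norm_nonneg (z + y * I)]

/-! ### [LSW] Lemma 6.2 when the real points of `A` lie to the right of `W_0` -/

/-- The real points of a nonempty bounded hull lying to the right of `W_0` have a minimum
`a₀ ∈ A`, `W_0 < a₀`. [folklore] -/
theorem exists_min_ofReal_of_driving_lt {A : Set ℂ} (hA : IsBoundedHull A)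
    (hreal : ∀ x : ℝ, (x : ℂ) ∈ A → W 0 < x) (hne : A.Nonempty) :
    ∃ a₀ : ℝ, W 0 < a₀ ∧ (a₀ : ℂ) ∈ A ∧ ∀ x : ℝ, (x : ℂ) ∈ A → a₀ ≤ x := by
  set S : Set ℝ := {x : ℝ | (x : ℂ) ∈ A} with hS
  have hSc : IsClosed S := hA.isClosed.preimage continuous_ofReal
  have hSb : Bornology.IsBounded S := by
    obtain ⟨R, hR⟩ := hA.1.subset_closedBall 0
    refine (Metric.isBounded_Icc (-R) R).subset fun x hx ↦ ?_
    have h := hR hx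
    rw [mem_closedBall, dist_zero_right, Complex.norm_real, Real.norm_eq_abs, abs_le] at h
    exact h
  have hSne : S.Nonempty := hA.exists_ofReal_mem hne
  have hcpt : IsCompact S := Metric.isCompact_of_isClosed_isBounded hSc hSb
  exact ⟨sInf S, hreal _ (hcpt.sInf_mem hSne), hcpt.sInf_mem hSne,
    fun x hx ↦ csInf_le hcpt.bddBelow hx⟩

/-- **The geometric core of [LSW] Lemma 6.2, for every continuous driving function.** Let `A`
be a nonempty bounded hull whose real points lie to the right of `W_0` and which is never met
by the closed hulls. Given `δ > 0`, for every large `r` and every exit time `t = T(r)` the slid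
hull `A_t − W_t` lies in a closed disc `D̄(p, m)` about a real `p > 0` with `m ≤ δ p`
("`diam(Ã)/inf{|W − z| : z ∈ Ã}` goes to zero"). Proof: with the exit point `z₀`
(`exists_exitPoint`), `a₀ = min (A ∩ ℝ)`, the connected set `A' = A ∪ [a₀, b]` of points still
flowing at time `t`, `p = g_t(a₀) − W_t` and `m = max_{A'} |g_t − g_t(a₀)|`: every semicircle
of radius `u ≤ m` about `g_t(a₀) - W_t` carries a point of `ℍ` whose `f_t`-preimage has small
modulus (intermediate value theorem on `A'`, `exists_mem_sphere_of_ofReal`), every semicircle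
about `0` carries a point whose preimage lies on the vertical above `z₀`, of modulus `> r`
(`exists_norm_map_vertical_sub_driving_eq`, from the key limit
`norm_map_sub_driving_lt_of_vertical`); the two families of `mul_log_le_of_forall_crossing_or_overlap`
cross inside `ℍ`, so one of them crosses a fixed annulus of logarithmic width `≍ log (r/R₀)`,
and the length–area inequality bounds `m/p`.
[cite: LawlerSchrammWerner2003Restriction, proof of Lemma 6.2] -/
theorem exists_slidHull_subset_closedBall_of_driving_lt (hW : Continuous W) {A : Set ℂ}
    (hA : IsBoundedHull A) (hreal : ∀ x : ℝ, (x : ℂ) ∈ A → W 0 < x) (hne : A.Nonempty)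
    (hdisj : ∀ t, Disjoint (closedHull W t) A) {δ : ℝ} (hδ : 0 < δ) :
    ∃ r₀ : ℝ, ∀ r : ℝ, r₀ ≤ r → ∀ t : ℝ≥0, IsExitTime W r t →
      ∃ p m : ℝ, 0 < p ∧ 0 ≤ m ∧ m ≤ δ * p ∧ slidHull W A t ⊆ closedBall (p : ℂ) m := by
  classical
  -- the hull: leftmost real point `a₀`, base interval `[a₀, b]`, connected `A' = A ∪ [a₀, b]`
  obtain ⟨a₀, ha₀, ha₀A, hmin⟩ := exists_min_ofReal_of_driving_lt hA hreal hne
  obtain ⟨R, hR⟩ := hA.1.subset_closedBall 0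
  set b : ℝ := max R a₀ with hbdef
  have ha₀b : a₀ ≤ b := le_max_right _ _
  have hAnorm : ∀ z ∈ A, ‖z‖ ≤ R := fun z hz ↦ by
    have := hR hz
    rwa [mem_closedBall, dist_zero_right] at this
  have hrealIcc : ∀ x : ℝ, (x : ℂ) ∈ A → x ∈ Icc a₀ b := fun x hx ↦
    ⟨hmin x hx, by
      have h := hAnorm _ hx
      rw [Complex.norm_real, Real.norm_eq_abs] at h
      exact ((le_abs_self x).trans h).trans (le_max_left _ _)⟩
  set A' : Set ℂ := A ∪ Complex.ofReal '' Icc a₀ b with hA'def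
  have hA'conn : IsConnected A' := hA.isConnected_union_ofReal_image ha₀b hrealIcc
  have hA'cpt : IsCompact A' := hA.isCompact.union (isCompact_Icc.image continuous_ofReal)
  have ha₀A' : (a₀ : ℂ) ∈ A' := Or.inl ha₀A
  set R₀ : ℝ := |R| + |a₀| + 1 with hR₀def
  have hR₀pos : 0 < R₀ := by positivity
  have hIccnorm : ∀ x ∈ Icc a₀ b, ‖(x : ℂ)‖ < R₀ := fun x hx ↦ by
    rw [Complex.norm_real, Real.norm_eq_abs, hR₀def]
    have h1 : x ≤ max R a₀ := hx.2
    have h2 : a₀ ≤ x := hx.1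
    rcases le_or_gt 0 x with h0 | h0
    · rw [abs_of_nonneg h0]
      rcases le_total R a₀ with h3 | h3
      · rw [max_eq_right h3] at h1; linarith [le_abs_self a₀, abs_nonneg R]
      · rw [max_eq_left h3] at h1; linarith [le_abs_self R, abs_nonneg a₀]
    · rw [abs_of_neg h0]; linarith [neg_le_abs a₀, abs_nonneg R]
  have hA'norm : ∀ z ∈ A', ‖z‖ < R₀ := by
    rintro z (hz | ⟨x, hx, rfl⟩)
    · exact (hAnorm z hz).trans_lt (by rw [hR₀def]; linarith [le_abs_self R, abs_nonneg a₀])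
    · exact hIccnorm x hx
  -- the thresholds
  set δ₂ : ℝ := min δ (1 / 4) with hδ₂
  have hδ₂pos : 0 < δ₂ := lt_min hδ (by norm_num)
  set L₀ : ℝ := (2 * π ^ 2 + 4 * π ^ 2 / δ₂) / Real.log 2 + 1 with hL₀
  have hlog2 : 0 < Real.log 2 := Real.log_pos (by norm_num)
  have hL₀pos : 0 < L₀ := by positivity
  set r₀ : ℝ := max (‖(W 0 : ℂ)‖ + 1) (max (64 * R₀ + 1) (R₀ * (4 * Real.exp L₀) ^ 2)) with hr₀
  refine ⟨r₀, fun r hr t hex ↦ ?_⟩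
  -- consequences of `r ≥ r₀`
  have hrW : ‖(W 0 : ℂ)‖ < r := lt_of_lt_of_le (lt_add_one _) ((le_max_left _ _).trans hr)
  have hr64 : 64 * R₀ + 1 ≤ r := ((le_max_left _ _).trans (le_max_right _ _)).trans hr
  have hrpos : 0 < r := by nlinarith
  have hR₀r : R₀ < r := by nlinarith
  have hrexp : R₀ * (4 * Real.exp L₀) ^ 2 ≤ r :=
    ((le_max_right _ _).trans (le_max_right _ _)).trans hr
  set R₁ : ℝ := 2 * R₀ with hR₁
  set R₃ : ℝ := Real.sqrt (R₀ * r) with hR₃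
  set R₂ : ℝ := R₃ / 2 with hR₂
  set R₄ : ℝ := r / 2 with hR₄
  have hR₃pos : 0 < R₃ := Real.sqrt_pos.2 (by positivity)
  have hR₃sq : R₃ ^ 2 = R₀ * r := Real.sq_sqrt (by positivity)
  have hQ : Real.exp L₀ ≤ R₂ / R₁ := by
    have h1 : R₀ * (4 * Real.exp L₀) ≤ R₃ := by
      rw [hR₃, ← Real.sqrt_sq (by positivity : 0 ≤ R₀ * (4 * Real.exp L₀))]
      exact Real.sqrt_le_sqrt (by nlinarith [Real.exp_pos L₀])
    rw [hR₂, hR₁, le_div_iff₀ (by positivity)]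
    linarith
  have hexp1 : 1 < Real.exp L₀ := by
    have := Real.add_one_le_exp L₀
    linarith
  have hR₁₂ : R₁ < R₂ := by
    have : 1 < R₂ / R₁ := hexp1.trans_le hQ
    rwa [one_lt_div (by positivity)] at this
  have hR₂₃ : R₂ < R₃ := by rw [hR₂]; linarith
  have hR₃₄ : R₃ < R₄ := by
    rw [hR₄]
    nlinarith
  have hR₄r : R₄ < r := by rw [hR₄]; linarith
  set Lr : ℝ := Real.log (R₂ / R₁) with hLr
  have hLrL₀ : L₀ ≤ Lr := by
    rw [hLr, ← Real.log_exp L₀]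
    exact Real.log_le_log (Real.exp_pos _) hQ
  have hLrpos : 0 < Lr := hL₀pos.trans_le hLrL₀
  have hL₂ : Lr ≤ Real.log (R₄ / R₃) := by
    refine Real.log_le_log (by positivity) ?_
    rw [hR₂, hR₄, hR₁, div_le_div_iff₀ (by positivity) (by positivity)]
    nlinarith
  -- the exit point and the key limit
  obtain ⟨z₀, hz₀K, hrz₀, hmax⟩ := exists_exitPoint hW hex
  have hz₀T : swallowingTime W z₀ = t := swallowingTime_exitPoint hex hz₀K hrz₀
  have hz₀W : z₀ ≠ W 0 := fun h ↦ by
    rw [h] at hrz₀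
    exact absurd hrz₀ (not_le.2 hrW)
  have ht : 0 < t := by
    have := swallowingTime_pos_holds hW hz₀W
    rw [hz₀T] at this
    exact_mod_cast this
  have hdom : ∀ y : ℝ, 0 < y → z₀ + y * I ∈ domain W t := fun y hy ↦
    add_mul_I_mem_domain_of_max hz₀K.1 hmax hy
  have hlim : ∀ η : ℝ, 0 < η → ∃ y₀ > 0, ∀ y : ℝ, 0 < y → y ≤ y₀ →
      ‖map W t (z₀ + y * I) - W t‖ < η := fun η hη ↦
    norm_map_sub_driving_lt_of_vertical hW ht hz₀T hdom hη
  -- the chain at time `t`; points of `A'` are still flowing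
  set g : ℂ → ℂ := map W t with hg
  set c : ℝ := W t with hc
  have ha₀T : ∀ s : ℝ≥0, (s : WithTop ℝ≥0) < swallowingTime W a₀ := fun s ↦
    lt_swallowingTime_of_disjoint_closedHull hA.subset_closure (hdisj s) ha₀A
  have hflowA : ∀ z ∈ A, (t : WithTop ℝ≥0) < swallowingTime W z := fun z hz ↦
    lt_swallowingTime_of_disjoint_closedHull hA.subset_closure (hdisj t) hz
  have hflowI : ∀ x ∈ Icc a₀ b, (t : WithTop ℝ≥0) < swallowingTime W x := fun x hx ↦
    (ha₀T t).trans_le (swallowingTime_mono_right hW ha₀ hx.1)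
  have hflow : ∀ z ∈ A', (t : WithTop ℝ≥0) < swallowingTime W z := by
    rintro z (hz | ⟨x, hx, rfl⟩)
    · exact hflowA z hz
    · exact hflowI x hx
  have hcases : ∀ z ∈ A', z ∈ domain W t ∨ ∃ x : ℝ, x ∈ Icc a₀ b ∧ z = x := by
    intro z hz
    rcases hz with hzA | ⟨x, hx, rfl⟩
    · rcases (hA.im_nonneg hzA).eq_or_lt with h0 | hpos
      · right
        have hz' : z = ((z.re : ℝ) : ℂ) := by
          rw [← Complex.re_add_im z, ← h0]; simp
        rw [hz'] at hzA
        exact ⟨z.re, hrealIcc _ hzA, hz'⟩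
      · exact Or.inl ((mem_domain_iff _ _ _).2 ⟨hpos, hflowA z hzA⟩)
    · exact Or.inr ⟨x, hx, rfl⟩
  have hgc : ContinuousOn g A' := fun z hz ↦ (continuousAt_map hW (hflow z hz)).continuousWithinAt
  -- the centre `p` and the size `m`
  set p : ℝ := (g a₀).re - c with hp
  have hppos : 0 < p := by
    have := driving_lt_map_ofReal_re hW ha₀ (ha₀T t)
    rw [hp]; linarith
  have hga₀im : (g a₀).im = 0 := map_ofReal_im hW (ha₀T t)
  set φ : ℂ → ℝ := fun z ↦ ‖g z - c - p‖ with hφ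
  have hφc : ContinuousOn φ A' := ((hgc.sub continuousOn_const).sub continuousOn_const).norm
  have hφreal : ∀ x ∈ Icc a₀ b, φ x = (g x).re - (g a₀).re := by
    intro x hx
    have hge : (g a₀).re ≤ (g x).re := map_ofReal_re_le_of_le hW ha₀ hx.1 (ha₀T t) (hflowI x hx)
    have key : g x - c - p = (((g x).re - (g a₀).re : ℝ) : ℂ) := by
      refine Complex.ext ?_ ?_
      · simp only [sub_re, ofReal_re, hp]; ring
      · simp only [sub_im, ofReal_im, sub_zero]
        exact map_ofReal_im hW (hflowI x hx)
    show ‖g x - c - p‖ = _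
    rw [key, Complex.norm_real, Real.norm_eq_abs, abs_of_nonneg (by linarith)]
  have hφa₀ : φ a₀ = 0 := by
    rw [hφreal a₀ ⟨le_rfl, ha₀b⟩, sub_self]
  obtain ⟨zmax, hzmaxA', hzmax⟩ := hA'cpt.exists_isMaxOn ⟨_, ha₀A'⟩ hφc
  set m : ℝ := φ zmax with hm
  have hm0 : 0 ≤ m := norm_nonneg _
  have hmle : ∀ z ∈ A', φ z ≤ m := fun z hz ↦ hzmax hz
  have hsub : slidHull W A t ⊆ closedBall (p : ℂ) m := by
    rintro _ ⟨z, hz, rfl⟩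
    rw [mem_closedBall, dist_eq_norm]
    exact hmle z (Or.inl hz)
  refine ⟨p, m, hppos, hm0, ?_, hsub⟩
  -- KEY: `m ≤ δ p`
  rcases hm0.eq_or_lt with hm00 | hmpos
  · rw [← hm00]; positivity
  set m' : ℝ := min m (p / 2) with hm'
  have hm'pos : 0 < m' := lt_min hmpos (by positivity)
  have hm'p2 : m' ≤ p / 2 := min_le_right _ _
  have hm'p : m' < p := hm'p2.trans_lt (by linarith)
  have hm'm : m' ≤ m := min_le_left _ _
  -- the shifted inverse `fT w = f_t (w + W_t)`
  set fT : ℂ → ℂ := fun w ↦ loewnerInv W t (w + c) with hfT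
  have hshift : ∀ w : ℂ, w ∈ upperHalfPlaneSet ↔ w + c ∈ upperHalfPlaneSet := fun w ↦ by
    simp [upperHalfPlaneSet]
  have hf : DifferentiableOn ℂ fT upperHalfPlaneSet :=
    (differentiableOn_invFunOn_map hW t).comp (differentiableOn_id.add_const _)
      fun w hw ↦ (hshift w).1 hw
  have hinj : InjOn fT upperHalfPlaneSet := by
    intro w₁ hw₁ w₂ hw₂ h
    have := (bijOn_invFunOn_map hW t).injOn ((hshift w₁).1 hw₁) ((hshift w₂).1 hw₂) h
    exact add_right_cancel this
  -- points of `Ã` on every semicircle of radius `u ≤ m` about `p`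
  have hApt : ∀ u : ℝ, 0 < u → u ≤ m → ∃ θ ∈ Ioo (0 : ℝ) π, ‖fT (circleMap (p : ℂ) u θ)‖ < R₀ := by
    intro u hu0 hum
    obtain ⟨zs, hzsA', hzsφ⟩ : ∃ zs ∈ A', φ zs = u := by
      have h := hA'conn.isPreconnected.intermediate_value ha₀A' hzmaxA' hφc
      rw [hφa₀] at h
      exact h ⟨hu0.le, hum⟩
    obtain ⟨w, hwim, hwu, hwR⟩ : ∃ w : ℂ, 0 < w.im ∧ ‖w - ((c + p : ℝ) : ℂ)‖ = u ∧
        ‖loewnerInv W t w‖ < R₀ := by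
      rcases hcases zs hzsA' with hdomz | ⟨x, hx, rfl⟩
      · refine ⟨g zs, mapsTo_map hW t hdomz, ?_, ?_⟩
        · rw [← hzsφ]
          show ‖g zs - ((c + p : ℝ) : ℂ)‖ = ‖g zs - c - p‖
          push_cast; ring_nf
        · rw [loewnerInv_map hW hdomz]; exact hA'norm zs hzsA'
      · have hxa₀ : a₀ < x := by
          rcases hx.1.eq_or_lt with h | h
          · exfalso
            rw [← h, hφa₀] at hzsφ
            exact hu0.ne hzsφ
          · exact h
        have hxT := hflowI x hx
        have hu' : (map W t x).re = (map W t a₀).re + u := by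
          have := hφreal x hx
          rw [hzsφ] at this
          show (g x).re = (g a₀).re + u
          linarith
        have hcenter : (((map W t a₀).re : ℝ) : ℂ) = ((c + p : ℝ) : ℂ) := by
          congr 1
          show (g a₀).re = c + p
          rw [hp]; ring
        obtain ⟨w, hw1, hw2, hw3⟩ := exists_mem_sphere_of_ofReal hW ha₀ hxa₀ (ha₀T t) hxT hu'
          (hIccnorm x hx)
        exact ⟨w, hw1, by rwa [hcenter] at hw2, hw3⟩
    have hwim' : ((p : ℝ) : ℂ).im < (w - c).im := by simpa using hwim
    obtain ⟨θ, hθ, hθw⟩ := exists_circleMap_eq_of_im_lt hwim'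
    refine ⟨θ, hθ, ?_⟩
    have hwu' : ‖w - c - p‖ = u := by
      rw [← hwu]; congr 1; push_cast; ring
    rw [hwu'] at hθw
    show ‖loewnerInv W t (circleMap (p : ℂ) u θ + c)‖ < R₀
    rw [hθw, sub_add_cancel]
    exact hwR
  -- far points on every semicircle about `0`
  have hfar : ∀ ρ : ℝ, 0 < ρ → ∃ θ ∈ Ioo (0 : ℝ) π, r < ‖fT (circleMap 0 ρ θ)‖ := by
    intro ρ hρ
    obtain ⟨y, hy, hyρ⟩ := exists_norm_map_vertical_sub_driving_eq hW hdom hlim hρ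
    have hwim : (0 : ℂ).im < (g (z₀ + y * I) - c).im := by
      simpa using mapsTo_map hW t (hdom y hy)
    obtain ⟨θ, hθ, hθw⟩ := exists_circleMap_eq_of_im_lt hwim
    rw [sub_zero, hyρ] at hθw
    refine ⟨θ, hθ, ?_⟩
    show r < ‖loewnerInv W t (circleMap 0 ρ θ + c)‖
    rw [hθw, sub_add_cancel, loewnerInv_map hW (hdom y hy)]
    exact hrz₀.trans_lt (norm_lt_norm_add_mul_I hz₀K.1 hy)
  -- the crossing dichotomy
  have hcross : ∀ u ∈ Ioo (m' / 2) m',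
      (∃ θ' ∈ Ioo (0 : ℝ) π, ∃ θ'' ∈ Ioo (0 : ℝ) π,
        ‖fT (circleMap (p : ℂ) u θ')‖ < R₁ ∧ R₂ < ‖fT (circleMap (p : ℂ) u θ'')‖) ∨
      (∃ θ' ∈ Ioo (0 : ℝ) π, ∃ θ'' ∈ Ioo (0 : ℝ) π,
        ‖fT (circleMap 0 (p + m' / 2 - u) θ')‖ < R₃ ∧
          R₄ < ‖fT (circleMap 0 (p + m' / 2 - u) θ'')‖) := by
    intro u hu
    have hu0 : 0 < u := (half_pos hm'pos).trans hu.1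
    have hum : u ≤ m := hu.2.le.trans hm'm
    obtain ⟨θa, hθa, hsmall⟩ := hApt u hu0 hum
    have hqu : 0 < p + m' / 2 - u := by linarith [hu.2]
    obtain ⟨θb, hθb, hbig⟩ := hfar (p + m' / 2 - u) hqu
    obtain ⟨j, hjim, hj1, hj2⟩ := exists_mem_inter_spheres (p := p) (q := p + m' / 2) (u := u)
      hppos (by linarith) (by linarith [hu.1]) (by linarith [hu.2])
    have hjim₁ : ((p : ℝ) : ℂ).im < j.im := by simpa using hjim
    have hjim₂ : (0 : ℂ).im < j.im := by simpa using hjim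
    obtain ⟨θ₁, hθ₁, hθ₁j⟩ := exists_circleMap_eq_of_im_lt hjim₁
    obtain ⟨θ₂, hθ₂, hθ₂j⟩ := exists_circleMap_eq_of_im_lt hjim₂
    rw [hj1] at hθ₁j
    rw [sub_zero, hj2] at hθ₂j
    by_cases hcase : R₂ < ‖fT j‖
    · left
      refine ⟨θa, hθa, θ₁, hθ₁, hsmall.trans (by rw [hR₁]; linarith), ?_⟩
      rw [hθ₁j]; exact hcase
    · right
      refine ⟨θ₂, hθ₂, θb, hθb, ?_, hR₄r.trans hbig⟩
      rw [hθ₂j]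
      exact (not_lt.1 hcase).trans_lt hR₂₃
  -- the length–area inequality
  have hineq := mul_log_le_of_forall_crossing_or_overlap hf hinj (by positivity : 0 < R₁) hR₁₂
    hR₃pos hR₃₄ hLrpos le_rfl hL₂ hm'pos hm'p hcross
  -- `m' (Lr log 2 − 2π²) ≤ 4π² p` with `Lr log 2 − 2π² > 4π²/δ₂`
  set K : ℝ := Lr * Real.log 2 - 2 * π ^ 2 with hKdef
  have hK : 4 * π ^ 2 / δ₂ < K := by
    have h1 : L₀ * Real.log 2 ≤ Lr * Real.log 2 := mul_le_mul_of_nonneg_right hLrL₀ hlog2.le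
    have h2 : L₀ * Real.log 2 = 2 * π ^ 2 + 4 * π ^ 2 / δ₂ + Real.log 2 := by
      rw [hL₀]
      field_simp
    rw [hKdef]
    linarith
  have hKpos : 0 < K := lt_trans (by positivity) hK
  have hm'K : m' * K ≤ 4 * π ^ 2 * p := by
    have : m' * K = Lr * Real.log 2 * m' - 2 * π ^ 2 * m' := by rw [hKdef]; ring
    rw [this]
    linarith
  have hδK : 4 * π ^ 2 < K * δ₂ := (div_lt_iff₀ hδ₂pos).1 hK
  have hm'lt : m' < δ₂ * p := by
    by_contra hle
    rw [not_lt] at hle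
    have h1 : δ₂ * p * K ≤ m' * K := mul_le_mul_of_nonneg_right hle hKpos.le
    have h2 : 4 * π ^ 2 * p < K * δ₂ * p := mul_lt_mul_of_pos_right hδK hppos
    have h3 : K * δ₂ * p = δ₂ * p * K := by ring
    linarith
  have hδ₂4 : δ₂ ≤ 1 / 4 := min_le_right _ _
  have hm'lt' : m' < p / 4 := by
    have : δ₂ * p ≤ 1 / 4 * p := mul_le_mul_of_nonneg_right hδ₂4 hppos.le
    linarith
  have hmm' : m' = m := by
    rw [hm']
    refine min_eq_left ?_
    by_contra hlt
    rw [not_le] at hlt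
    have : m' = p / 2 := by rw [hm']; exact min_eq_right hlt.le
    linarith
  rw [← hmm']
  have hδ₂δ : δ₂ * p ≤ δ * p := mul_le_mul_of_nonneg_right (min_le_left _ _) hppos.le
  linarith

/-- **[LSW] Lemma 6.2 for a hull to the right of the driving point**: for a continuous driving
function `W`, a `*`-hull `A` whose real points are `> W_0` and which is never met by the closed
hulls, and `ε > 0`: at every exit time `t = T(r)` of a large disc, `Φ'_{A_t − W_t}(0) > 1 − ε`
(for any restriction data of the slid hull, which is a `*`-hull by
`isStarHull_slidHull_of_disjoint`). From `exists_slidHull_subset_closedBall_of_driving_lt`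
and the comparison with thin half-ellipse hulls `exists_delta_lt_restrictionDeriv` ("`g_B'(W)`
is invariant under scaling … and is monotone decreasing in `B`"). For `W_0 = 0` and `A ∈ 𝒬₊`
this is the printed Lemma 6.2. [cite: LawlerSchrammWerner2003Restriction, Lemma 6.2] -/
theorem restrictionDeriv_exitTime_gt_of_driving_lt (hW : Continuous W) {A : Set ℂ}
    (hA : IsStarHull A) (hreal : ∀ x : ℝ, (x : ℂ) ∈ A → W 0 < x)
    (hdisj : ∀ t, Disjoint (closedHull W t) A) {ε : ℝ} (hε : 0 < ε) :
    ∃ r₀ : ℝ, ∀ r : ℝ, r₀ ≤ r → ∀ t : ℝ≥0, IsExitTime W r t →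
      ∀ (Ψ : ConformalEquiv (upperHalfPlaneSet \ slidHull W A t) upperHalfPlaneSet) (e : ℝ),
        IsRestrictionMap (slidHull W A t) Ψ → HasRestrictionDeriv (slidHull W A t) Ψ e →
          1 - ε < e := by
  rcases A.eq_empty_or_nonempty with rfl | hne
  · refine ⟨0, fun r _ t _ Ψ e hΨ he ↦ ?_⟩
    have key : ∀ B : Set ℂ, B = ∅ →
        ∀ (Ψ : ConformalEquiv (upperHalfPlaneSet \ B) upperHalfPlaneSet) (e : ℝ),
          IsRestrictionMap B Ψ → HasRestrictionDeriv B Ψ e → e = 1 := by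
      rintro B rfl Ψ e hΨ he
      exact HasRestrictionDeriv.eq_of_isRestrictionMap
        IsStarHull.existsUnique_isRestrictionMap_holds isStarHull_empty isRestrictionMap_empty hΨ
        hasRestrictionDeriv_empty he
    rw [key _ (slidHull_empty W t) Ψ e hΨ he]
    linarith
  · obtain ⟨δ, hδ, hcomp⟩ := exists_delta_lt_restrictionDeriv hε
    obtain ⟨r₀, hr₀⟩ :=
      exists_slidHull_subset_closedBall_of_driving_lt hW hA.isBoundedHull hreal hne hdisj hδ
    refine ⟨r₀, fun r hr t hex Ψ e hΨ he ↦ ?_⟩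
    obtain ⟨p, m, hp, -, hmp, hsub⟩ := hr₀ r hr t hex
    have hstar : IsStarHull (slidHull W A t) := isStarHull_slidHull_of_disjoint hW hA (hdisj t)
    exact hcomp hp hstar (hsub.trans (closedBall_subset_closedBall hmp)) hΨ he

/-! ### [LSW] Lemma 6.2 when the real points of `A` lie to the left of `W_0`: reflection -/

/-- **[LSW] Lemma 6.2 for a hull to the left of the driving point**, by the symmetry
`σ(z) = −z̄`: the chain driven by `−W` and the hull `σ(A)` (whose real points are `> −W_0`)
have the same exit times, reflected closed and slid hulls and the same numbers `Φ'(0)`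
(`LoewnerReflection`), so `restrictionDeriv_exitTime_gt_of_driving_lt` transfers ([LSW] proof
of Thm. 6.1: "By symmetry"). [cite: LawlerSchrammWerner2003Restriction, Lemma 6.2 and proof of Thm. 6.1] -/
theorem restrictionDeriv_exitTime_gt_of_lt_driving (hW : Continuous W) {A : Set ℂ}
    (hA : IsStarHull A) (hreal : ∀ x : ℝ, (x : ℂ) ∈ A → x < W 0)
    (hdisj : ∀ t, Disjoint (closedHull W t) A) {ε : ℝ} (hε : 0 < ε) :
    ∃ r₀ : ℝ, ∀ r : ℝ, r₀ ≤ r → ∀ t : ℝ≥0, IsExitTime W r t →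
      ∀ (Ψ : ConformalEquiv (upperHalfPlaneSet \ slidHull W A t) upperHalfPlaneSet) (e : ℝ),
        IsRestrictionMap (slidHull W A t) Ψ → HasRestrictionDeriv (slidHull W A t) Ψ e →
          1 - ε < e := by
  have hdisj' : ∀ t, Disjoint (closedHull (fun s ↦ -W s) t)
      (Literature.Probability.RandomPlanarGeometry.imagAxisRefl '' A) := fun t ↦ by
    rw [closedHull_imagAxisRefl]
    exact (disjoint_image_iff imagAxisRefl.injective).2 (hdisj t)
  have hreal' : ∀ x : ℝ, (x : ℂ) ∈ Literature.Probability.RandomPlanarGeometry.imagAxisRefl '' A →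
      (fun s ↦ -W s) 0 < x := by
    rintro x ⟨z, hz, hzx⟩
    have hz' : z = ((-x : ℝ) : ℂ) := by
      have := congrArg Literature.Probability.RandomPlanarGeometry.imagAxisRefl hzx
      rwa [imagAxisRefl_imagAxisRefl, imagAxisRefl_ofReal] at this
    have := hreal (-x) (hz' ▸ hz)
    show -W 0 < x
    linarith
  obtain ⟨r₀, hr₀⟩ := restrictionDeriv_exitTime_gt_of_driving_lt hW.neg hA.image_imagAxisRefl
    hreal' hdisj' hε
  refine ⟨r₀, fun r hr t ht Ψ e hΨ he ↦ ?_⟩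
  obtain ⟨Ψ', hΨ', he'⟩ :=
    exists_restrictionData_of_image (slidHull_imagAxisRefl hW A t).symm Ψ hΨ he
  exact hr₀ r hr t (isExitTime_neg_iff.2 ht) Ψ' e hΨ' he'

end Loewner

/-! ### Translating hulls along the real axis -/

/-- **`𝒬` is invariant under real translations** (the translation is a homeomorphism of `ℂ`
preserving `ℍ`). [folklore] -/
theorem IsBoundedHull.image_add_const {A : Set ℂ} (hA : IsBoundedHull A) (a : ℝ) :
    IsBoundedHull ((fun z ↦ z + (a : ℂ)) '' A) := by
  obtain ⟨hb, hcl, hsc⟩ := hA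
  set τ : ℂ ≃ₜ ℂ := Homeomorph.addRight (a : ℂ) with hτ
  have hτim : ∀ S : Set ℂ, τ '' S = (fun z ↦ z + (a : ℂ)) '' S := fun S ↦ rfl
  have hH : τ '' upperHalfPlaneSet = upperHalfPlaneSet := by
    ext z
    simp only [hτ, Homeomorph.coe_addRight, mem_image, upperHalfPlaneSet, mem_setOf_eq]
    constructor
    · rintro ⟨w, hw, rfl⟩
      simpa using hw
    · intro hz
      exact ⟨z - a, by simpa using hz, by ring⟩
  rw [← hτim]
  refine ⟨?_, ?_, ?_⟩
  · obtain ⟨R, hR⟩ := hb.subset_closedBall 0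
    refine (isBounded_closedBall (x := (a : ℂ)) (r := R)).subset ?_
    rintro _ ⟨z, hz, rfl⟩
    have := hR hz
    rw [mem_closedBall, dist_zero_right] at this
    simpa [hτ, mem_closedBall, dist_eq_norm] using this
  · rw [← hH, ← image_inter τ.injective, ← τ.image_closure, hcl]
  · rw [← hH, ← image_sdiff τ.injective]
    exact τ.isSimplyConnected_image.2 hsc

namespace Loewner

variable {W : ℝ≥0 → ℝ}

/-! ### [LSW] Lemma 6.2 for every `*`-hull and every continuous driving function -/

/-- **[LSW] Lemma 6.2 for an arbitrary `*`-hull** `A` (and any continuous driving function):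
split `A` into the components attached to the real axis to the right of `W_0` and those
attached to the left (`IsStarHull.sidePart_decomposition` of the translate `A − W_0`, [LSW] §2
p. 8 "`A = A₁ · A₂`"), apply `restrictionDeriv_exitTime_gt_of_driving_lt` /
`…_of_lt_driving` to the two parts at the same exit times, and combine with the union bound
`1 − Φ'_{B₊ ∪ B₋}(0) ≤ (1 − Φ'_{B₊}(0)) + (1 − Φ'_{B₋}(0))` for the slid hulls
(`HasRestrictionDeriv.one_sub_le_add`; in [LSW] the union bound for the Brownian excursion,
Prop. 4.1, as in the proof of Thm. 6.1 for two-sided hulls).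
[cite: LawlerSchrammWerner2003Restriction, Lemma 6.2 with §2 p. 8 and Prop. 4.1] -/
theorem restrictionDeriv_exitTime_gt_of_isStarHull (hW : Continuous W) {A : Set ℂ}
    (hA : IsStarHull A) (hdisj : ∀ t, Disjoint (closedHull W t) A) {ε : ℝ} (hε : 0 < ε) :
    ∃ r₀ : ℝ, ∀ r : ℝ, r₀ ≤ r → ∀ t : ℝ≥0, IsExitTime W r t →
      ∀ (Ψ : ConformalEquiv (upperHalfPlaneSet \ slidHull W A t) upperHalfPlaneSet) (e : ℝ),
        IsRestrictionMap (slidHull W A t) Ψ → HasRestrictionDeriv (slidHull W A t) Ψ e →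
          1 - ε < e := by
  classical
  -- the translate `B = A − W_0` is a `*`-hull
  set w₀ : ℝ := W 0 with hw₀
  have hw₀K : ((w₀ : ℝ) : ℂ) ∈ closedHull W 0 :=
    ⟨show 0 ≤ ((W 0 : ℝ) : ℂ).im by simp, (swallowingTime_driving_le W).trans bot_le⟩
  have hw₀A : ((w₀ : ℝ) : ℂ) ∉ A := fun h ↦ Set.disjoint_left.1 (hdisj 0) hw₀K h
  set B : Set ℂ := (fun z ↦ z + ((-w₀ : ℝ) : ℂ)) '' A with hBdef
  have hB : IsStarHull B := by
    refine ⟨hA.isBoundedHull.image_add_const (-w₀), ?_⟩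
    rintro ⟨z, hz, hz0⟩
    have : z = (w₀ : ℂ) := by
      have h := hz0
      push_cast at h
      linear_combination h
    exact hw₀A (this ▸ hz)
  -- its side parts, translated back
  set P' : Set ℂ := sidePart B 1 with hP'
  set M' : Set ℂ := sidePart B (-1) with hM'
  have hP'h : IsPlusHull P' := hB.isPlusHull_plusPart
  have hM'h : IsMinusHull M' := hB.isMinusHull_minusPart
  have hunion' : P' ∪ M' = B := hB.plusPart_union_minusPart
  set P : Set ℂ := (fun z ↦ z + (w₀ : ℂ)) '' P' with hPdef
  set M : Set ℂ := (fun z ↦ z + (w₀ : ℂ)) '' M' with hMdef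
  have hback : (fun z ↦ z + (w₀ : ℂ)) '' B = A := by
    rw [hBdef, image_image]
    have : (fun z : ℂ ↦ z + ((-w₀ : ℝ) : ℂ) + (w₀ : ℂ)) = id := by
      funext z
      simp
    rw [this, image_id]
  have hunion : P ∪ M = A := by rw [hPdef, hMdef, ← image_union, hunion', hback]
  have hPA : P ⊆ A := hunion ▸ subset_union_left
  have hMA : M ⊆ A := hunion ▸ subset_union_right
  have hP : IsStarHull P := ⟨hP'h.1.isBoundedHull.image_add_const w₀, fun h ↦ hA.zero_notMem (hPA h)⟩
  have hM : IsStarHull M := ⟨hM'h.1.isBoundedHull.image_add_const w₀, fun h ↦ hA.zero_notMem (hMA h)⟩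
  have hPreal : ∀ x : ℝ, (x : ℂ) ∈ P → W 0 < x := by
    rintro x ⟨z, hz, hzx⟩
    have hz' : z = ((x - w₀ : ℝ) : ℂ) := by
      push_cast; linear_combination hzx
    have := hP'h.2 (x - w₀) (hz' ▸ hz)
    rw [hw₀] at this; linarith
  have hMreal : ∀ x : ℝ, (x : ℂ) ∈ M → x < W 0 := by
    rintro x ⟨z, hz, hzx⟩
    have hz' : z = ((x - w₀ : ℝ) : ℂ) := by
      push_cast; linear_combination hzx
    have := hM'h.2 (x - w₀) (hz' ▸ hz)
    rw [hw₀] at this; linarith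
  have hdisjP : ∀ t, Disjoint (closedHull W t) P := fun t ↦ (hdisj t).mono_right hPA
  have hdisjM : ∀ t, Disjoint (closedHull W t) M := fun t ↦ (hdisj t).mono_right hMA
  -- Lemma 6.2 for each part
  have hε2 : 0 < ε / 2 := by linarith
  obtain ⟨r₁, hr₁⟩ := restrictionDeriv_exitTime_gt_of_driving_lt hW hP hPreal hdisjP hε2
  obtain ⟨r₂, hr₂⟩ := restrictionDeriv_exitTime_gt_of_lt_driving hW hM hMreal hdisjM hε2
  refine ⟨max r₁ r₂, fun r hr t ht Ψ e hΨ he ↦ ?_⟩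
  -- the slid hulls
  have hBt : IsStarHull (slidHull W A t) := isStarHull_slidHull_of_disjoint hW hA (hdisj t)
  have hBP : IsStarHull (slidHull W P t) := isStarHull_slidHull_of_disjoint hW hP (hdisjP t)
  have hBM : IsStarHull (slidHull W M t) := isStarHull_slidHull_of_disjoint hW hM (hdisjM t)
  have hBunion : slidHull W P t ∪ slidHull W M t = slidHull W A t := by
    rw [← slidHull_union, hunion]
  obtain ⟨ΨP, hΨP, -⟩ := IsStarHull.existsUnique_isRestrictionMap_holds hBP
  obtain ⟨eP, -, -, heP⟩ := IsStarHull.exists_hasRestrictionDeriv_holds hBP hΨP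
  obtain ⟨ΨM, hΨM, -⟩ := IsStarHull.existsUnique_isRestrictionMap_holds hBM
  obtain ⟨eM, -, -, heM⟩ := IsStarHull.exists_hasRestrictionDeriv_holds hBM hΨM
  have h1 : 1 - ε / 2 < eP := hr₁ r ((le_max_left _ _).trans hr) t ht ΨP eP hΨP heP
  have h2 : 1 - ε / 2 < eM := hr₂ r ((le_max_right _ _).trans hr) t ht ΨM eM hΨM heM
  have hsub := HasRestrictionDeriv.one_sub_le_add hBP hBM hBt hBunion hΨP hΨM hΨ heP heM he
  linarith

/-- **[LSW] Lemma 6.2 holds** (`restrictionDeriv_exitTime_gt`): for `A ∈ 𝒬₊`, a continuous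
driving function whose closed hulls never meet `A`, and `ε > 0`, at every exit time
`t = T(r)` of a large disc `r𝕌` one has `g'_{A_t}(W_t) = Φ'_{A_t − W_t}(0) > 1 − ε`. A special
case of `restrictionDeriv_exitTime_gt_of_isStarHull`.
[cite: LawlerSchrammWerner2003Restriction, Lemma 6.2] -/
theorem restrictionDeriv_exitTime_gt_holds : restrictionDeriv_exitTime_gt :=
  fun hW _ hA hdisj _ hε ↦ restrictionDeriv_exitTime_gt_of_isStarHull hW hA.1 hdisj hε

end Loewner

end Literature.Probability.RandomPlanarGeometry

end
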